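import Summits.CriticalPhenomena.PercolationContinuityZ3.Theorems.PercNearOneGluingNoHeavyLowerTailSahiCombTriWAndClawPlusTwoGen
import Summits.CriticalPhenomena.PercolationContinuityZ3.Theorems.PercNearOneGluingNoHeavyLowerTailSahiCombTriWAndClawPlusTwoSmall

/-!
# AND with a claw with two doubled prongs, EVERY size `k ≥ 5` (wrapper)

Support file of the one-cut programme (crux `NoHeavyLowerTail`, stmt-CriticalPhenomena-4575; unit `prim-lf-1` gen 49): combines `…AndClawPlusTwo` (`k = 5`,
cocover5), `…AndClawPlusTwoSmall` (`k = 6, 7`) and `…AndClawPlusTwoGen` (`k ≥ 8`) into **`corP_andProd_clawPlusTwo_nonneg_all`** and its corollaries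
`triW_nonneg_andProd_clawPlusTwo_all`, `klShell_andProd_clawPlusTwo_all`, `lForm_le_scoreVal_andProd_clawPlusTwo_all`.
HONEST LABEL: complete proofs, std axioms; no new definitions. [this work]
-/

namespace Summit.CriticalPhenomena.PercolationContinuityZ3.Theorems

namespace FiveUpSet

open Finset

variable {γ₁ : Type} [DecidableEq γ₁] [Fintype γ₁] {k : ℕ}

/-! ### All sizes -/

section allsizes
variable {P₁ : Finset (Finset γ₁)} (hP : IsUpperSet (P₁ : Set (Finset γ₁))) (hd : Disjoint P₁ (refl P₁))
  (hcor : ∀ U V : Finset (Finset γ₁), IsUpperSet (U : Set (Finset γ₁)) → IsUpperSet (V : Set (Finset γ₁)) → 0 ≤ corP P₁ U V)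
  {A B : Finset (Finset (γ₁ ⊕ Fin k))} (hA : IsUpperSet (A : Set (Finset (γ₁ ⊕ Fin k)))) (hB : IsUpperSet (B : Set (Finset (γ₁ ⊕ Fin k))))
  {p₁ q₁ p₂ q₂ : Fin k} (hpq : p₁ ≠ q₁ ∧ p₂ ≠ q₂ ∧ p₁ ≠ p₂ ∧ p₁ ≠ q₂ ∧ q₁ ≠ p₂ ∧ q₁ ≠ q₂)

include hP hd hcor hA hB hpq in
/-- **THEOREM (AND with a claw with two doubled prongs, every `k ≥ 5`).**  `Cor_{P₁ ∧ clawPlusTwo p₁ q₁ p₂ q₂}(A,B) ≥ 0` for every antipode-free up-set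
`P₁` with `Cor_{P₁} ≥ 0`, all up-sets `A, B`, and any two disjoint pairs in `Fin k`, `k ≥ 5`. [this work] -/
theorem corP_andProd_clawPlusTwo_nonneg_all (hk : 5 ≤ k) : 0 ≤ corP (andProd P₁ (clawPlusTwo p₁ q₁ p₂ q₂)) A B := by
  rcases Nat.lt_or_ge k 8 with h8 | h8
  · rcases Nat.lt_or_ge k 6 with h6 | h6
    · obtain rfl : k = 5 := by omega
      exact corP_andProd_clawPlusTwo_nonneg hP hd hcor hA hB hpq
    · rcases Nat.lt_or_ge k 7 with h7 | h7
      · obtain rfl : k = 6 := by omega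
        exact corP_andProd_clawPlusTwo_nonneg_6 hP hd hcor hA hB hpq
      · obtain rfl : k = 7 := by omega
        exact corP_andProd_clawPlusTwo_nonneg_7 hP hd hcor hA hB hpq
  · exact corP_andProd_clawPlusTwo_nonneg_of_eight_le hP hd hcor hA hB hpq h8

end allsizes

variable {β : Type} [DecidableEq β] [Fintype β]

/-- **`TriWIneq` for `P₁ ∧ clawPlusTwo p₁ q₁ p₂ q₂`**, every `k ≥ 5`, on every index cube, for every intersecting Kleitman shell `P₁`. [this work] -/
theorem triW_nonneg_andProd_clawPlusTwo_all (hk : 5 ≤ k) {p₁ q₁ p₂ q₂ : Fin k}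
    (hpq : p₁ ≠ q₁ ∧ p₂ ≠ q₂ ∧ p₁ ≠ p₂ ∧ p₁ ≠ q₂ ∧ q₁ ≠ p₂ ∧ q₁ ≠ q₂) {P₁ : Finset (Finset γ₁)}
    (hP : IsUpperSet (P₁ : Set (Finset γ₁))) (hd : Disjoint P₁ (refl P₁))
    (hcor : ∀ U V : Finset (Finset γ₁), IsUpperSet (U : Set (Finset γ₁)) → IsUpperSet (V : Set (Finset γ₁)) → 0 ≤ corP P₁ U V)
    (F G : Finset β → Finset (Finset (γ₁ ⊕ Fin k)))
    (hF : ∀ x, IsUpperSet (F x : Set (Finset (γ₁ ⊕ Fin k)))) (hG : ∀ x, IsUpperSet (G x : Set (Finset (γ₁ ⊕ Fin k))))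
    (hFm : Monotone F) (hGm : Monotone G) :
    0 ≤ triW (andProd P₁ (clawPlusTwo p₁ q₁ p₂ q₂)) F G :=
  triW_nonneg_of_corP_nonneg (isUpperSet_andProd hP (isUpperSet_clawPlusTwo hpq))
    (fun _ _ hA hB => corP_andProd_clawPlusTwo_nonneg_all hP hd hcor hA hB hpq hk) F G hF hG hFm hGm

/-- **The AND-product is again an intersecting Kleitman shell**, every `k ≥ 5`. [this work] -/
theorem klShell_andProd_clawPlusTwo_all (hk : 5 ≤ k) {p₁ q₁ p₂ q₂ : Fin k}
    (hpq : p₁ ≠ q₁ ∧ p₂ ≠ q₂ ∧ p₁ ≠ p₂ ∧ p₁ ≠ q₂ ∧ q₁ ≠ p₂ ∧ q₁ ≠ q₂) {P₁ : Finset (Finset γ₁)}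
    (hP : IsUpperSet (P₁ : Set (Finset γ₁))) (hd : Disjoint P₁ (refl P₁))
    (hcor : ∀ U V : Finset (Finset γ₁), IsUpperSet (U : Set (Finset γ₁)) → IsUpperSet (V : Set (Finset γ₁)) → 0 ≤ corP P₁ U V) :
    KlShell (andProd P₁ (clawPlusTwo p₁ q₁ p₂ q₂) ∪ refl (andProd P₁ (clawPlusTwo p₁ q₁ p₂ q₂))) :=
  klShell_of_corP_nonneg (disjoint_andProd_refl hd _) fun _ _ hA hB => corP_andProd_clawPlusTwo_nonneg_all hP hd hcor hA hB hpq hk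

/-- **`AndShellLower` for `Q = clawPlusTwo p₁ q₁ p₂ q₂`**, every `k ≥ 5`. [this work] -/
theorem lForm_le_scoreVal_andProd_clawPlusTwo_all (hk : 5 ≤ k) {p₁ q₁ p₂ q₂ : Fin k}
    (hpq : p₁ ≠ q₁ ∧ p₂ ≠ q₂ ∧ p₁ ≠ p₂ ∧ p₁ ≠ q₂ ∧ q₁ ≠ p₂ ∧ q₁ ≠ q₂) {P₁ : Finset (Finset γ₁)}
    (hP : IsUpperSet (P₁ : Set (Finset γ₁))) (hd : Disjoint P₁ (refl P₁)) (hs : KlShell (P₁ ∪ refl P₁))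
    {A B : Finset (Finset (γ₁ ⊕ Fin k))} (hA : IsUpperSet (A : Set (Finset (γ₁ ⊕ Fin k)))) (hB : IsUpperSet (B : Set (Finset (γ₁ ⊕ Fin k)))) :
    lForm (andProd P₁ (clawPlusTwo p₁ q₁ p₂ q₂)) A B ≤ scoreVal (secFAScore P₁ (clawPlusTwo p₁ q₁ p₂ q₂)) A B :=
  lForm_le_scoreVal_secFAScore_of_corP_nonneg (disjoint_clawPlusTwo_refl hk hpq)
    (corP_andProd_clawPlusTwo_nonneg_all hP hd
      (fun U V hU hV => by rw [corP_eq_card_sub_card_of_disjoint hd]; exact hs U V hU hV) hA hB hpq hk)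

end FiveUpSet

end Summit.CriticalPhenomena.PercolationContinuityZ3.Theorems
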